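import Mathlib
import Summits.Ventures.PercRepro2.Defs
import Summits.Ventures.PercRepro2.Independence
import Summits.Ventures.PercRepro2.Harris
import Summits.Ventures.PercRepro2.Graph
import Summits.Ventures.PercRepro2.Events
import Summits.Ventures.PercRepro2.Induced
import Summits.Ventures.PercRepro2.BHK
import Summits.Ventures.PercRepro2.BHKEvents
import Summits.Ventures.PercRepro2.BHKMixed
import Summits.Ventures.PercRepro2.OneEdge
import Summits.Ventures.PercRepro2.RBRoot
import Summits.Ventures.PercRepro2.RBRootEdge
import Summits.Ventures.PercRepro2.RBRootEdgePin
import Summits.Ventures.PercRepro2.RBRootEdgeMain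
import Summits.Ventures.PercRepro2.RBRootEdgeT
import Summits.Ventures.PercRepro2.RBRootIsolated
import Summits.Ventures.PercRepro2.RBTwoMarkers
import Summits.Ventures.PercRepro2.RBTwoMarkersCross
import Summits.Ventures.PercRepro2.RBMarkerEdge

/-!
# Row 2′RB: removing a marker edge at the third vertex, II — the mixture and the theorems
(mine-a g6; MINE-A.md §39; proofs/MINEA-MARKEREDGE.md §2 (i)–(iii), §4)

For an edge `g = {w, b}` (weight `q`): the Rao–Blackwell sum is affine in `q`
(`RBTwoMarkers.rbSum_pin_same_marker`, `RBTwoMarkers.rbSum_pin_cross_b`), under `p[g ↦ 1]` it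
collapses to `P₁(Q ∩ bL ∩ oL)` / `P₁(Q ∩ bL ∩ oH)` (`rbSum_update_one_marker`,
`rbSum_update_one_cross_b`), and the mixture identity

  `(q j₁ z₀ + (1−q) a₀ c₀)(q z₁ + (1−q) z₀) − z₀ (q a₁ + (1−q) a₀)(q c₁ + (1−q) c₀)
     = q² z₀ (j₁ z₁ − a₁ c₁) + q (1−q) · BRACKET`

(`mix_same_marker`, `mix_cross_marker`) reduces both forms of the row at `p` to the row at
`p[g ↦ 0]`: the first term is BHK 1.3 / 1.4 on `G/g` (`RBRoot.same_collapsed` /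
`cross_collapsed`), the bracket is `RBMarkerEdge.bracket_same_nonneg` / `bracket_cross_nonpos`.
The edge `{w, o}` follows by the symmetries of the row (`RBRoot.rbSum_comm`,
`RBRootEdge.rbSum_swap`). Main theorems: `same_of_update_marker_b`, `cross_of_update_marker_b`,
`same_of_update_marker_o`, `cross_of_update_marker_o`.
-/

namespace Summit.Ventures.PercRepro2

namespace RBMarkerEdge

open scoped Classical

section Mixture

variable {R : Type*} [Field R] [LinearOrder R] [IsStrictOrderedRing R]

/-- **The marker-edge mixture inequality, same form.** -/
lemma mix_same_marker {q a₀ a₁ c₀ c₁ z₀ z₁ j₁ rb₀ : R} (hq0 : 0 ≤ q) (hq1 : q ≤ 1)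
    (ha₀ : 0 ≤ a₀) (ha₀z : a₀ ≤ z₀) (hc₀ : 0 ≤ c₀) (hc₀z : c₀ ≤ z₀)
    (ha₁ : 0 ≤ a₁) (ha₁z : a₁ ≤ z₁) (hc₁ : 0 ≤ c₁) (hc₁z : c₁ ≤ z₁) (hj : 0 ≤ j₁) (hrb : 0 ≤ rb₀)
    (hbhk : a₁ * c₁ / z₁ ≤ j₁)
    (hbr : 0 ≤ j₁ * z₀ ^ 2 + a₀ * c₀ * z₁ - z₀ * a₁ * c₀ - z₀ * a₀ * c₁)
    (h₀ : a₀ * c₀ / z₀ ≤ rb₀) :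
    (q * a₁ + (1 - q) * a₀) * (q * c₁ + (1 - q) * c₀) / (q * z₁ + (1 - q) * z₀) ≤
      q * j₁ + (1 - q) * rb₀ := by
  have hq1' : 0 ≤ 1 - q := sub_nonneg.2 hq1
  have hqj : 0 ≤ q * j₁ := mul_nonneg hq0 hj
  have hqrb : 0 ≤ (1 - q) * rb₀ := mul_nonneg hq1' hrb
  rcases eq_or_lt_of_le (ha₁.trans ha₁z) with hz₁ | hz₁
  · -- `z₁ = 0`: `a₁ = c₁ = 0`
    have ha₁' : a₁ = 0 := le_antisymm (hz₁ ▸ ha₁z) ha₁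
    have hc₁' : c₁ = 0 := le_antisymm (hz₁ ▸ hc₁z) hc₁
    rw [← hz₁, ha₁', hc₁']
    simp only [mul_zero, zero_add]
    rcases eq_or_lt_of_le hq1' with hq | hq
    · rw [← hq]
      simp only [zero_mul, div_zero]
      linarith
    · rcases eq_or_lt_of_le (ha₀.trans ha₀z) with hz₀ | hz₀
      · have ha₀' : a₀ = 0 := le_antisymm (hz₀ ▸ ha₀z) ha₀
        rw [← hz₀, ha₀']
        simp only [mul_zero, zero_mul, zero_div]
        linarith
      · rw [mul_mul_mul_comm, mul_assoc, mul_div_mul_left _ _ hq.ne', mul_div_assoc]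
        linarith [mul_le_mul_of_nonneg_left h₀ hq1']
  rcases eq_or_lt_of_le (ha₀.trans ha₀z) with hz₀ | hz₀
  · -- `z₀ = 0`: `a₀ = c₀ = 0`
    have ha₀' : a₀ = 0 := le_antisymm (hz₀ ▸ ha₀z) ha₀
    have hc₀' : c₀ = 0 := le_antisymm (hz₀ ▸ hc₀z) hc₀
    rw [← hz₀, ha₀', hc₀']
    simp only [mul_zero, add_zero]
    rcases eq_or_lt_of_le hq0 with hq | hq
    · rw [← hq]
      simp only [zero_mul, div_zero]
      linarith
    · rw [mul_mul_mul_comm, mul_assoc, mul_div_mul_left _ _ hq.ne', mul_div_assoc]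
      linarith [mul_le_mul_of_nonneg_left hbhk hq0]
  -- both `z₀, z₁ > 0`
  have hbhk' : a₁ * c₁ ≤ j₁ * z₁ := (div_le_iff₀ hz₁).1 hbhk
  have hZ : 0 < q * z₁ + (1 - q) * z₀ := by
    rcases eq_or_lt_of_le hq0 with hq | hq
    · rw [← hq]; simpa using hz₀
    · positivity
  have hid : (q * j₁ * z₀ + (1 - q) * (a₀ * c₀)) * (q * z₁ + (1 - q) * z₀) -
      (q * a₁ + (1 - q) * a₀) * (q * c₁ + (1 - q) * c₀) * z₀ =
      q ^ 2 * z₀ * (j₁ * z₁ - a₁ * c₁) +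
        q * (1 - q) * (j₁ * z₀ ^ 2 + a₀ * c₀ * z₁ - z₀ * a₁ * c₀ - z₀ * a₀ * c₁) := by ring
  have hnn : 0 ≤ q ^ 2 * z₀ * (j₁ * z₁ - a₁ * c₁) +
      q * (1 - q) * (j₁ * z₀ ^ 2 + a₀ * c₀ * z₁ - z₀ * a₁ * c₀ - z₀ * a₀ * c₁) :=
    add_nonneg (mul_nonneg (mul_nonneg (sq_nonneg q) hz₀.le) (sub_nonneg.2 hbhk'))
      (mul_nonneg (mul_nonneg hq0 hq1') hbr)
  have hstep : (q * a₁ + (1 - q) * a₀) * (q * c₁ + (1 - q) * c₀) / (q * z₁ + (1 - q) * z₀) ≤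
      (q * j₁ * z₀ + (1 - q) * (a₀ * c₀)) / z₀ := by
    rw [div_le_div_iff₀ hZ hz₀]
    linarith [hid, hnn]
  have hstep2 : (q * j₁ * z₀ + (1 - q) * (a₀ * c₀)) / z₀ = q * j₁ + (1 - q) * (a₀ * c₀ / z₀) := by
    rw [add_div, mul_div_assoc, div_self hz₀.ne', mul_one, mul_div_assoc]
  rw [hstep2] at hstep
  linarith [hstep, mul_le_mul_of_nonneg_left h₀ hq1']

/-- **The marker-edge mixture inequality, cross form.** -/
lemma mix_cross_marker {q a₀ a₁ d₀ d₁ z₀ z₁ k₁ rb₀ : R} (hq0 : 0 ≤ q) (hq1 : q ≤ 1)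
    (ha₀ : 0 ≤ a₀) (ha₀z : a₀ ≤ z₀) (hd₀ : 0 ≤ d₀) (hd₀z : d₀ ≤ z₀)
    (ha₁ : 0 ≤ a₁) (ha₁z : a₁ ≤ z₁) (hd₁ : 0 ≤ d₁) (hd₁z : d₁ ≤ z₁) (hk : 0 ≤ k₁) (hkz : k₁ ≤ z₁)
    (hbhk : k₁ ≤ a₁ * d₁ / z₁)
    (hbr : k₁ * z₀ ^ 2 + a₀ * d₀ * z₁ - z₀ * a₁ * d₀ - z₀ * a₀ * d₁ ≤ 0)
    (h₀ : rb₀ ≤ a₀ * d₀ / z₀) :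
    q * k₁ + (1 - q) * rb₀ ≤
      (q * a₁ + (1 - q) * a₀) * (q * d₁ + (1 - q) * d₀) / (q * z₁ + (1 - q) * z₀) := by
  have hq1' : 0 ≤ 1 - q := sub_nonneg.2 hq1
  rcases eq_or_lt_of_le (ha₁.trans ha₁z) with hz₁ | hz₁
  · -- `z₁ = 0`: `a₁ = d₁ = k₁ = 0`
    have ha₁' : a₁ = 0 := le_antisymm (hz₁ ▸ ha₁z) ha₁
    have hd₁' : d₁ = 0 := le_antisymm (hz₁ ▸ hd₁z) hd₁
    have hk' : k₁ = 0 := le_antisymm (hz₁ ▸ hkz) hk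
    rw [← hz₁, ha₁', hd₁', hk']
    simp only [mul_zero, zero_add]
    rcases eq_or_lt_of_le hq1' with hq | hq
    · rw [← hq]
      simp
    · rcases eq_or_lt_of_le (ha₀.trans ha₀z) with hz₀ | hz₀
      · have ha₀' : a₀ = 0 := le_antisymm (hz₀ ▸ ha₀z) ha₀
        rw [← hz₀, ha₀'] at h₀ ⊢
        simp only [mul_zero, zero_mul, zero_div] at h₀ ⊢
        linarith [mul_le_mul_of_nonneg_left h₀ hq1']
      · rw [mul_mul_mul_comm, mul_assoc, mul_div_mul_left _ _ hq.ne', mul_div_assoc]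
        exact mul_le_mul_of_nonneg_left h₀ hq1'
  rcases eq_or_lt_of_le (ha₀.trans ha₀z) with hz₀ | hz₀
  · -- `z₀ = 0`: `a₀ = d₀ = 0`, `rb₀ ≤ 0`
    have ha₀' : a₀ = 0 := le_antisymm (hz₀ ▸ ha₀z) ha₀
    have hd₀' : d₀ = 0 := le_antisymm (hz₀ ▸ hd₀z) hd₀
    rw [← hz₀, ha₀', hd₀'] at h₀ ⊢
    simp only [mul_zero, add_zero, zero_div] at h₀ ⊢
    rcases eq_or_lt_of_le hq0 with hq | hq
    · rw [← hq]
      simp only [zero_mul, div_zero, sub_zero, one_mul, zero_add]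
      exact h₀
    · rw [mul_mul_mul_comm, mul_assoc, mul_div_mul_left _ _ hq.ne', mul_div_assoc]
      linarith [mul_le_mul_of_nonneg_left hbhk hq0, mul_le_mul_of_nonneg_left h₀ hq1']
  -- both `z₀, z₁ > 0`
  have hbhk' : k₁ * z₁ ≤ a₁ * d₁ := (le_div_iff₀ hz₁).1 hbhk
  have hZ : 0 < q * z₁ + (1 - q) * z₀ := by
    rcases eq_or_lt_of_le hq0 with hq | hq
    · rw [← hq]; simpa using hz₀
    · positivity
  have hid : (q * a₁ + (1 - q) * a₀) * (q * d₁ + (1 - q) * d₀) * z₀ -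
      (q * k₁ * z₀ + (1 - q) * (a₀ * d₀)) * (q * z₁ + (1 - q) * z₀) =
      q ^ 2 * z₀ * (a₁ * d₁ - k₁ * z₁) -
        q * (1 - q) * (k₁ * z₀ ^ 2 + a₀ * d₀ * z₁ - z₀ * a₁ * d₀ - z₀ * a₀ * d₁) := by ring
  have hnn : 0 ≤ q ^ 2 * z₀ * (a₁ * d₁ - k₁ * z₁) -
      q * (1 - q) * (k₁ * z₀ ^ 2 + a₀ * d₀ * z₁ - z₀ * a₁ * d₀ - z₀ * a₀ * d₁) :=
    sub_nonneg.2 (le_trans (mul_nonpos_of_nonneg_of_nonpos (mul_nonneg hq0 hq1') hbr)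
      (mul_nonneg (mul_nonneg (sq_nonneg q) hz₀.le) (sub_nonneg.2 hbhk')))
  have hstep : (q * k₁ * z₀ + (1 - q) * (a₀ * d₀)) / z₀ ≤
      (q * a₁ + (1 - q) * a₀) * (q * d₁ + (1 - q) * d₀) / (q * z₁ + (1 - q) * z₀) := by
    rw [div_le_div_iff₀ hz₀ hZ]
    linarith [hid, hnn]
  have hstep2 : (q * k₁ * z₀ + (1 - q) * (a₀ * d₀)) / z₀ = q * k₁ + (1 - q) * (a₀ * d₀ / z₀) := by
    rw [add_div, mul_div_assoc, div_self hz₀.ne', mul_one, mul_div_assoc]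
  rw [hstep2] at hstep
  linarith [hstep, mul_le_mul_of_nonneg_left h₀ hq1']

end Mixture

section Theorems

variable {V : Type*} {E : Type*} [Fintype E] [DecidableEq E] [Fintype V] [DecidableEq V]
  {R : Type*} [Field R] [LinearOrder R] [IsStrictOrderedRing R]
  (ends : E → Sym2 V) {p : E → R}

/-- **The marker edge `{w, b}` can be removed — (RB-same)**: the cleared same form at `p` follows
from the cleared same form at `p[g ↦ 0]`. -/
theorem same_of_update_marker_b (hp : IsProbVec p) {s t w o b : V} {g : E}
    (hends : ends g = s(w, b))
    (h0 : prob (Function.update p g 0) ((connEvent ends s t)ᶜ ∩ connEvent ends b s) *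
        prob (Function.update p g 0) ((connEvent ends s t)ᶜ ∩ connEvent ends o s) /
        prob (Function.update p g 0) (connEvent ends s t)ᶜ ≤
      RBRoot.rbSum (Function.update p g 0) ends s t w (connEvent ends b s) (connEvent ends o s)) :
    prob p ((connEvent ends s t)ᶜ ∩ connEvent ends b s) *
        prob p ((connEvent ends s t)ᶜ ∩ connEvent ends o s) / prob p (connEvent ends s t)ᶜ ≤
      RBRoot.rbSum p ends s t w (connEvent ends b s) (connEvent ends o s) := by
  have hp0 : IsProbVec (Function.update p g 0) := hp.update g le_rfl zero_le_one
  have hp1 : IsProbVec (Function.update p g 1) := hp.update g zero_le_one le_rfl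
  rw [RBTwoMarkers.rbSum_pin_same_marker ends s t w hp hends o,
    RBTwoMarkers.rbSum_update_one_marker ends s t w p hp hends o,
    prob_eq_pin p ((connEvent ends s t)ᶜ ∩ connEvent ends b s) g,
    prob_eq_pin p ((connEvent ends s t)ᶜ ∩ connEvent ends o s) g,
    prob_eq_pin p (connEvent ends s t)ᶜ g]
  exact mix_same_marker (hp.nonneg g) (hp.le_one g) (prob_nonneg hp0 _)
    (prob_mono hp0 Set.inter_subset_left) (prob_nonneg hp0 _) (prob_mono hp0 Set.inter_subset_left)
    (prob_nonneg hp1 _) (prob_mono hp1 Set.inter_subset_left) (prob_nonneg hp1 _)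
    (prob_mono hp1 Set.inter_subset_left) (prob_nonneg hp1 _) (RBRoot.rbSum_nonneg ends hp0 s t w _ _)
    (RBRoot.same_collapsed ends hp1 o b s t) (bracket_same_nonneg ends s t w b o p hp hends) h0

/-- **The marker edge `{w, b}` can be removed — (RB-cross).** -/
theorem cross_of_update_marker_b (hp : IsProbVec p) {s t w o b : V} {g : E}
    (hends : ends g = s(w, b))
    (h0 : RBRoot.rbSum (Function.update p g 0) ends s t w (connEvent ends b s) (connEvent ends o t) ≤
      prob (Function.update p g 0) ((connEvent ends s t)ᶜ ∩ connEvent ends b s) *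
        prob (Function.update p g 0) ((connEvent ends s t)ᶜ ∩ connEvent ends o t) /
        prob (Function.update p g 0) (connEvent ends s t)ᶜ) :
    RBRoot.rbSum p ends s t w (connEvent ends b s) (connEvent ends o t) ≤
      prob p ((connEvent ends s t)ᶜ ∩ connEvent ends b s) *
        prob p ((connEvent ends s t)ᶜ ∩ connEvent ends o t) / prob p (connEvent ends s t)ᶜ := by
  have hp0 : IsProbVec (Function.update p g 0) := hp.update g le_rfl zero_le_one
  have hp1 : IsProbVec (Function.update p g 1) := hp.update g zero_le_one le_rfl
  rw [RBTwoMarkers.rbSum_pin_cross_b ends s t w hp hends o,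
    RBTwoMarkers.rbSum_update_one_cross_b ends s t w p hp hends o,
    prob_eq_pin p ((connEvent ends s t)ᶜ ∩ connEvent ends b s) g,
    prob_eq_pin p ((connEvent ends s t)ᶜ ∩ connEvent ends o t) g,
    prob_eq_pin p (connEvent ends s t)ᶜ g]
  exact mix_cross_marker (hp.nonneg g) (hp.le_one g) (prob_nonneg hp0 _)
    (prob_mono hp0 Set.inter_subset_left) (prob_nonneg hp0 _) (prob_mono hp0 Set.inter_subset_left)
    (prob_nonneg hp1 _) (prob_mono hp1 Set.inter_subset_left) (prob_nonneg hp1 _)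
    (prob_mono hp1 Set.inter_subset_left) (prob_nonneg hp1 _)
    (prob_mono hp1 (Set.inter_subset_left.trans Set.inter_subset_left))
    (RBRoot.cross_collapsed ends hp1 o b s t) (bracket_cross_nonpos ends s t w b o p hp hends) h0

/-- **The marker edge `{w, o}` can be removed — (RB-same)** (the same form is symmetric in the
two markers). -/
theorem same_of_update_marker_o (hp : IsProbVec p) {s t w o b : V} {g : E}
    (hends : ends g = s(w, o))
    (h0 : prob (Function.update p g 0) ((connEvent ends s t)ᶜ ∩ connEvent ends b s) *
        prob (Function.update p g 0) ((connEvent ends s t)ᶜ ∩ connEvent ends o s) /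
        prob (Function.update p g 0) (connEvent ends s t)ᶜ ≤
      RBRoot.rbSum (Function.update p g 0) ends s t w (connEvent ends b s) (connEvent ends o s)) :
    prob p ((connEvent ends s t)ᶜ ∩ connEvent ends b s) *
        prob p ((connEvent ends s t)ᶜ ∩ connEvent ends o s) / prob p (connEvent ends s t)ᶜ ≤
      RBRoot.rbSum p ends s t w (connEvent ends b s) (connEvent ends o s) := by
  rw [RBRoot.rbSum_comm, mul_comm]
  refine same_of_update_marker_b ends hp (o := b) (b := o) hends ?_
  rw [RBRoot.rbSum_comm, mul_comm]
  exact h0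

/-- **The marker edge `{w, o}` can be removed — (RB-cross)** (the cross form with the roots and the
markers exchanged). -/
theorem cross_of_update_marker_o (hp : IsProbVec p) {s t w o b : V} {g : E}
    (hends : ends g = s(w, o))
    (h0 : RBRoot.rbSum (Function.update p g 0) ends s t w (connEvent ends b s) (connEvent ends o t) ≤
      prob (Function.update p g 0) ((connEvent ends s t)ᶜ ∩ connEvent ends b s) *
        prob (Function.update p g 0) ((connEvent ends s t)ᶜ ∩ connEvent ends o t) /
        prob (Function.update p g 0) (connEvent ends s t)ᶜ) :
    RBRoot.rbSum p ends s t w (connEvent ends b s) (connEvent ends o t) ≤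
      prob p ((connEvent ends s t)ᶜ ∩ connEvent ends b s) *
        prob p ((connEvent ends s t)ᶜ ∩ connEvent ends o t) / prob p (connEvent ends s t)ᶜ := by
  have key := cross_of_update_marker_b ends hp (s := t) (t := s) (w := w) (o := b) (b := o) hends
  rw [RBRootEdge.rbSum_swap (p := Function.update p g 0) ends s t w,
    RBRootEdge.rbSum_swap (p := p) ends s t w, RBRoot.compl_connEvent_comm ends t s] at key
  have h := key (by rw [mul_comm]; exact h0)
  rw [mul_comm] at h
  exact h

end Theorems

end RBMarkerEdge

end Summit.Ventures.PercRepro2
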